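import Literature.NumberTheory.Automorphic.UnitaryAntidiagFrames            -- ★ `B₀`, `B₀_apply`, `isHermitianForm_B₀`, `mem_unitaryGroupOfForm_antidiagonal_iff`
import Literature.FieldTheory.FiniteFields.QuadraticTraceKernelCount         -- ★ `exists_trace_eq`, `frob_frob`; brings ★ `HermitianSphereCount.natCard_norm_eq` and Mathlib
import HarnessLib

/-!
# R90 · S6 — LINE S1, REGIME R-II TRANSPORT RUNG T, FILE T1: THE RESIDUAL EIGENFRAME OF A UNITARY `ḡ ∈ U₃(𝓀)` WITH `χ_ḡ = (X − c₁)²(X − c₂)`, `c₁ ≠ c₂`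
# (`Theorems/R90S6ResidualTwoCongruentEigenframe.lean`)

Cell `hodgecm-mathlib`, crux H413 (`stmt-HodgeConjecture-24833`), route of record `HCCMUnconditional`; programme R90-TF, section S6 (base `R90-C14`), seat R90-C14-p05 (g0);
S6 dealer R90-C14-plan (g2) RULING G1-R3 01:30:33Z «R-II TRANSPORT RUNG T is ON PATH — FILE T1 (over 𝓀) + FILE T2 (GL₃(𝒪)-lift)».  Helper lane `--supports
stmt-HodgeConjecture-24833 --as helper`; ONE theorem (no definition, no instance, no notation, no named fact, no `sorry`); purely residual: any finite field `k` with
`|k| = q²` and `τ = Frob_q` (the letters of ★ `HermitianSphereCount` ∕ ★ `QuadraticTraceKernelCount`), the split hermitian form `B₀ τ 3` of ★ `UnitaryAntidiagFrames`.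

THE MATHEMATICS [Wilson2009, §3.6; Tits1979, §3.5; Serre1980Trees, II.1.1].  Let `g ∈ U(τ, J₀)(k)` have `χ_g = (X − c₁)²(X − c₂)` with `c₁ ≠ c₂` of norm one
(`τ(cᵢ)cᵢ = 1`).  By Cayley–Hamilton and Bézout, `k³ = W₁ ⊕ W₂`, `W₁ = ker (g − c₁)²` (dimension 2), `W₂ = ker (g − c₂)` (dimension 1 = the multiplicity of the simple
root `c₂`, Mathlib `LinearMap.finrank_eigenspace_le`); the functional `B₀(·, v)` (`v ∈ W₂`) satisfies `B₀((g − c₁)x, v) = (c₂⁻¹ − τc₁)·B₀(x, v)` with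
`c₂⁻¹ − τc₁ = c₂⁻¹ − c₁⁻¹ ≠ 0`, so `W₁ ⊥ W₂` and both pieces are non-degenerate; in particular a generator `p₂` of `W₂` is ANISOTROPIC.  On the plane `W₁`,
`N = g − c₁` has `N² = 0`: EITHER `N ≠ 0` — then `p₁ = Np₀ ≠ 0` is a `c₁`-eigenvector, ISOTROPIC by unitarity (`c₁·B₀(p₁,p₁) = 0` from `B₀(gp₀, gp₁) = B₀(p₀,p₁)`),
and in the basis `(p₀, p₁, p₂)` the matrix of `g` is `c₁ ⊕ c₂` plus the single entry `A₁₀ = 1` — OR `N = 0` (`g = c₁` on `W₁`), and the non-degenerate hermitian plane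
`W₁` over the finite field carries a HYPERBOLIC PAIR `p₀, p₁` (isotropic, `B₀(p₀,p₁) ≠ 0`; from the surjectivity of norm ★ `natCard_norm_eq` and trace ★ `exists_trace_eq`
onto the `τ`-fixed field), giving the diagonal matrix `diag(c₁, c₁, c₂)`.  This is exactly the residual shape of the frame hypothesis `hframe` of ★ rung 1′
`R90S6TorusFixedSpecialCountTwoCongruent`; FILE T2 lifts it to `GL₃(𝒪)`.
HONEST LABEL: finite-field linear algebra only; count-neutral until T2 consumes it; proves no printed statement.  HC_CM is proved only modulo the 7 printed citations
(2 remaining named inputs: hLiu418 = stmt-HodgeConjecture-24832, h413 = stmt-HodgeConjecture-24833) until rung 0 closes.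
-/

set_option autoImplicit false
-- the mandated namespace repeats the single-problem summit's segment (`HodgeConjecture.HodgeConjecture`)
set_option linter.dupNamespace false

noncomputable section

open Polynomial Module
open Literature.NumberTheory.Automorphic Literature.NumberTheory.Automorphic.HermitianLattice Literature.NumberTheory.Automorphic.UnitaryGroup
open Literature.FieldTheory.FiniteFields
open scoped Matrix MatrixGroups

namespace Summit.HodgeConjecture.HodgeConjecture.R90.S6

/-- **FILE T1 — THE RESIDUAL EIGENFRAME OF A TWO-CONGRUENT UNITARY ELEMENT.**  For `g ∈ U(τ, J₀)(k)` over a finite field `k` (`|k| = q²`, `τ = Frob_q`) with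
`χ_g = (X − c₁)²(X − c₂)`, `c₁ ≠ c₂`, `τ(cᵢ)cᵢ = 1`: there is `P ∈ GL₃(k)` such that `A = P⁻¹gP` has `A₀₀ = A₁₁ = c₁`, `A₂₂ = c₂`, all off-diagonal entries other
than `A₁₀` zero, `B₀(Pe₂,Pe₂) ≠ 0`, `B₀(Pe₁,Pe₁) = 0`, and — when `A₁₀ = 0` — `B₀(Pe₀,Pe₀) = 0`, `B₀(Pe₀,Pe₁) ≠ 0` (a hyperbolic pair).
[cite: Wilson2009, §3.6] [cite: Tits1979, §3.5] -/
theorem exists_eigenframe_of_charpoly_two_congruent {k : Type*} [Field k] [Fintype k] {q : ℕ} (hq : Fintype.card k = q ^ 2)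
    (τ : k →+* k) (hτ : ∀ x, τ x = x ^ q)
    (g : GL (Fin 3) k) (hg : g ∈ unitaryGroupOfForm τ ((StdForm.antidiagonal 3).over k))
    {c₁ c₂ : k} (h12 : c₁ ≠ c₂) (hu₁ : τ c₁ * c₁ = 1) (hu₂ : τ c₂ * c₂ = 1)
    (hχ : (g : Matrix (Fin 3) (Fin 3) k).charpoly = (X - C c₁) ^ 2 * (X - C c₂)) :
    ∃ P : GL (Fin 3) k,
      (((P⁻¹ : GL (Fin 3) k) : Matrix (Fin 3) (Fin 3) k) * (g : Matrix (Fin 3) (Fin 3) k) * (P : Matrix (Fin 3) (Fin 3) k)) 0 0 = c₁ ∧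
      (((P⁻¹ : GL (Fin 3) k) : Matrix (Fin 3) (Fin 3) k) * (g : Matrix (Fin 3) (Fin 3) k) * (P : Matrix (Fin 3) (Fin 3) k)) 1 1 = c₁ ∧
      (((P⁻¹ : GL (Fin 3) k) : Matrix (Fin 3) (Fin 3) k) * (g : Matrix (Fin 3) (Fin 3) k) * (P : Matrix (Fin 3) (Fin 3) k)) 2 2 = c₂ ∧
      (∀ i j : Fin 3, i ≠ j → (i, j) ≠ ((1 : Fin 3), (0 : Fin 3)) →
        (((P⁻¹ : GL (Fin 3) k) : Matrix (Fin 3) (Fin 3) k) * (g : Matrix (Fin 3) (Fin 3) k) * (P : Matrix (Fin 3) (Fin 3) k)) i j = 0) ∧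
      B₀ τ 3 ((P : Matrix (Fin 3) (Fin 3) k).mulVec (Pi.single 2 1)) ((P : Matrix (Fin 3) (Fin 3) k).mulVec (Pi.single 2 1)) ≠ 0 ∧
      B₀ τ 3 ((P : Matrix (Fin 3) (Fin 3) k).mulVec (Pi.single 1 1)) ((P : Matrix (Fin 3) (Fin 3) k).mulVec (Pi.single 1 1)) = 0 ∧
      ((((P⁻¹ : GL (Fin 3) k) : Matrix (Fin 3) (Fin 3) k) * (g : Matrix (Fin 3) (Fin 3) k) * (P : Matrix (Fin 3) (Fin 3) k)) 1 0 = 0 →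
        B₀ τ 3 ((P : Matrix (Fin 3) (Fin 3) k).mulVec (Pi.single 0 1)) ((P : Matrix (Fin 3) (Fin 3) k).mulVec (Pi.single 0 1)) = 0 ∧
        B₀ τ 3 ((P : Matrix (Fin 3) (Fin 3) k).mulVec (Pi.single 0 1)) ((P : Matrix (Fin 3) (Fin 3) k).mulVec (Pi.single 1 1)) ≠ 0) := by
  classical
  have hττ : ∀ x, τ (τ x) = x := frob_frob hq τ hτ
  set gM : Matrix (Fin 3) (Fin 3) k := (g : Matrix (Fin 3) (Fin 3) k) with hgM
  -- the form
  have hB : ∀ u v, B₀ τ 3 (gM *ᵥ u) (gM *ᵥ v) = B₀ τ 3 u v := (mem_unitaryGroupOfForm_antidiagonal_iff g).1 hg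
  have herm : ∀ x y : Fin 3 → k, B₀ τ 3 y x = τ (B₀ τ 3 x y) := fun x y => (isHermitianForm_B₀ hττ x y).symm
  have hBsl : ∀ (c : k) (x y : Fin 3 → k), B₀ τ 3 (c • x) y = τ c * B₀ τ 3 x y := fun c x y => by
    rw [LinearMap.map_smulₛₗ, LinearMap.smul_apply, smul_eq_mul]
  have hBsr : ∀ (c : k) (x y : Fin 3 → k), B₀ τ 3 x (c • y) = c * B₀ τ 3 x y := fun c x y => by rw [map_smul, smul_eq_mul]
  have hnondeg : ∀ x : Fin 3 → k, (∀ y, B₀ τ 3 x y = 0) → x = 0 := by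
    intro x hx
    funext i
    have h := hx (Pi.single (Fin.rev i) 1)
    rw [B₀_apply, Finset.sum_eq_single i (fun b _ hb => by rw [Pi.single_eq_of_ne (fun h => hb (Fin.rev_injective h)), mul_zero])
      (fun h => absurd (Finset.mem_univ i) h), Pi.single_eq_same, mul_one] at h
    have h' : τ (τ (x i)) = τ 0 := by rw [h]
    rwa [hττ, map_zero] at h'
  -- scalars
  have hc₁0 : c₁ ≠ 0 := fun h => by rw [h, mul_zero] at hu₁; exact zero_ne_one hu₁
  have hc₂0 : c₂ ≠ 0 := fun h => by rw [h, mul_zero] at hu₂; exact zero_ne_one hu₂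
  have hτc₁ : τ c₁ = c₁⁻¹ := eq_inv_of_mul_eq_one_left hu₁
  have hτc₂ : τ c₂ = c₂⁻¹ := eq_inv_of_mul_eq_one_left hu₂
  -- the operators `N = g − c₁`, `M = g − c₂` on `V = k³` and the two kernels
  set f : Module.End k (Fin 3 → k) := Matrix.toLin' gM with hf
  obtain ⟨N, hN⟩ : ∃ N : (Fin 3 → k) → (Fin 3 → k), ∀ x, N x = gM *ᵥ x - c₁ • x := ⟨_, fun _ => rfl⟩
  have hNlin : ∀ (a b : k) (x y : Fin 3 → k), N (a • x + b • y) = a • N x + b • N y := fun a b x y => by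
    rw [hN, hN, hN, Matrix.mulVec_add, Matrix.mulVec_smul, Matrix.mulVec_smul, smul_sub, smul_sub, smul_comm a c₁, smul_comm b c₁, smul_add]; abel
  have hN0 : N 0 = 0 := by rw [hN, Matrix.mulVec_zero, smul_zero, sub_zero]
  set W₁ : Submodule k (Fin 3 → k) := LinearMap.ker (aeval f ((X - C c₁) ^ 2)) with hW₁
  set W₂ : Submodule k (Fin 3 → k) := LinearMap.ker (aeval f (X - C c₂)) with hW₂
  have haevalsub : ∀ c : k, ∀ x, aeval f (X - C c) x = gM *ᵥ x - c • x := fun c x => by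
    rw [map_sub, aeval_X, aeval_C, LinearMap.sub_apply, hf, Matrix.toLin'_apply, Module.algebraMap_end_apply]
  have hmemW₁ : ∀ x, x ∈ W₁ ↔ N (N x) = 0 := fun x => by
    rw [hW₁, LinearMap.mem_ker, map_pow, pow_two, Module.End.mul_apply, haevalsub, haevalsub, hN, hN]
  have hmemW₂ : ∀ x, x ∈ W₂ ↔ gM *ᵥ x = c₂ • x := fun x => by
    rw [hW₂, LinearMap.mem_ker, haevalsub, sub_eq_zero]
  -- CAYLEY–HAMILTON + BÉZOUT: `V = W₁ ⊕ W₂`, `finrank W₂ = 1`, `finrank W₁ = 2`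
  have hfχ : f.charpoly = (X - C c₁) ^ 2 * (X - C c₂) := by rw [hf, Matrix.charpoly_toLin', hχ]
  have hcop : IsCoprime ((X - C c₁) ^ 2) (X - C c₂) :=
    (isCoprime_X_sub_C_of_isUnit_sub (sub_ne_zero.2 h12).isUnit).pow_left
  have hsup : W₁ ⊔ W₂ = ⊤ := by
    rw [hW₁, hW₂, sup_ker_aeval_eq_ker_aeval_mul_of_coprime f hcop, ← hfχ, LinearMap.aeval_self_charpoly, LinearMap.ker_zero]
  have hdisj : Disjoint W₁ W₂ := disjoint_ker_aeval_of_isCoprime f hcop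
  have hsum : finrank k W₁ + finrank k W₂ = 3 := by
    have h := Submodule.finrank_sup_add_finrank_inf_eq W₁ W₂
    rw [hsup, hdisj.eq_bot, finrank_bot, add_zero, finrank_top, Module.finrank_fin_fun] at h
    exact h.symm
  have hW₂eig : W₂ = f.eigenspace c₂ := by
    rw [Module.End.eigenspace_def, hW₂, map_sub, aeval_X, aeval_C, Algebra.algebraMap_eq_smul_one]
  have hne : (X - C c₁) ^ 2 * (X - C c₂) ≠ 0 := mul_ne_zero (pow_ne_zero _ (X_sub_C_ne_zero c₁)) (X_sub_C_ne_zero c₂)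
  have hroot₂ : ((X - C c₁) ^ 2 * (X - C c₂)).rootMultiplicity c₂ = 1 := by
    have hnr : ¬ IsRoot ((X - C c₁) ^ 2) c₂ := by
      rw [IsRoot, eval_pow, eval_sub, eval_X, eval_C]; exact pow_ne_zero _ (sub_ne_zero.2 (Ne.symm h12))
    rw [rootMultiplicity_mul hne, rootMultiplicity_eq_zero hnr, rootMultiplicity_X_sub_C_self, zero_add]
  have hW₂le : finrank k W₂ ≤ 1 := by
    have h := LinearMap.finrank_eigenspace_le f c₂
    rwa [← hW₂eig, hfχ, hroot₂] at h
  have hev : f.HasEigenvalue c₂ := by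
    rw [Module.End.hasEigenvalue_iff_isRoot_charpoly, hfχ, IsRoot, eval_mul, eval_sub, eval_X, eval_C, sub_self, mul_zero]
  obtain ⟨v₂, hv₂⟩ := hev.exists_hasEigenvector
  have hv₂W : v₂ ∈ W₂ := by rw [hW₂eig]; exact hv₂.1
  have hv₂0 : v₂ ≠ 0 := hv₂.2
  have hgv₂ : gM *ᵥ v₂ = c₂ • v₂ := (hmemW₂ v₂).1 hv₂W
  have hW₂1 : finrank k W₂ = 1 := by
    refine le_antisymm hW₂le (Module.finrank_pos_iff_exists_ne_zero.2 ⟨⟨v₂, hv₂W⟩, fun h => hv₂0 (congrArg Subtype.val h)⟩)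
  have hW₁2 : finrank k W₁ = 2 := by omega
  -- every vector of `W₂` is a multiple of `v₂`; every vector of `V` is `w + v`, `w ∈ W₁`, `v ∈ W₂`
  have hW₂span : ∀ v ∈ W₂, ∃ c : k, c • v₂ = v := fun v hv => by
    obtain ⟨c, hc⟩ := (finrank_eq_one_iff_of_nonzero' (⟨v₂, hv₂W⟩ : W₂) (fun h => hv₂0 (congrArg Subtype.val h))).1 hW₂1 ⟨v, hv⟩
    exact ⟨c, congrArg Subtype.val hc⟩
  have hdec : ∀ y : Fin 3 → k, ∃ w ∈ W₁, ∃ v ∈ W₂, y = w + v := fun y => by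
    have hy : y ∈ W₁ ⊔ W₂ := by rw [hsup]; exact Submodule.mem_top
    obtain ⟨w, hw, v, hv, hwv⟩ := Submodule.mem_sup.1 hy
    exact ⟨w, hw, v, hv, hwv.symm⟩
  -- ORTHOGONALITY `W₁ ⊥ W₂` (the functional `B₀(·, v)`), non-degeneracy of `W₁`, anisotropy of `v₂`
  have hBNv : ∀ x v, gM *ᵥ v = c₂ • v → B₀ τ 3 (N x) v = (c₂⁻¹ - τ c₁) * B₀ τ 3 x v := by
    intro x v hv
    have h := hB x v
    rw [hv, hBsr] at h
    have h1 : B₀ τ 3 (gM *ᵥ x) v = c₂⁻¹ * B₀ τ 3 x v := by rw [← h, ← mul_assoc, inv_mul_cancel₀ hc₂0, one_mul]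
    rw [hN, map_sub, LinearMap.sub_apply, hBsl, h1]; ring
  have hd : c₂⁻¹ - τ c₁ ≠ 0 := by rw [hτc₁, sub_ne_zero]; exact fun h => h12 (inv_injective h).symm
  have hperp : ∀ w ∈ W₁, ∀ v ∈ W₂, B₀ τ 3 w v = 0 := by
    intro w hw v hv
    have hv' := (hmemW₂ v).1 hv
    have h := hBNv (N w) v hv'
    rw [(hmemW₁ w).1 hw, map_zero, LinearMap.zero_apply, hBNv w v hv'] at h
    rcases mul_eq_zero.1 h.symm with h0 | h0
    · exact absurd h0 hd
    · rcases mul_eq_zero.1 h0 with h1 | h1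
      · exact absurd h1 hd
      · exact h1
  have hperp' : ∀ v ∈ W₂, ∀ w ∈ W₁, B₀ τ 3 v w = 0 := fun v hv w hw => by rw [herm, hperp w hw v hv, map_zero]
  have hW₁nondeg : ∀ w ∈ W₁, (∀ w' ∈ W₁, B₀ τ 3 w w' = 0) → w = 0 := by
    intro w hw h
    refine hnondeg w fun y => ?_
    obtain ⟨w', hw', v, hv, rfl⟩ := hdec y
    rw [map_add, h w' hw', hperp w hw v hv, add_zero]
  have hv₂an : B₀ τ 3 v₂ v₂ ≠ 0 := by
    intro h0
    refine hv₂0 (hnondeg v₂ fun y => ?_)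
    obtain ⟨w', hw', v, hv, rfl⟩ := hdec y
    obtain ⟨c, rfl⟩ := hW₂span v hv
    rw [map_add, hperp' v₂ hv₂W w' hw', hBsr, h0, mul_zero, add_zero]
  -- ASSEMBLY: adapted vectors `p₀, p₁ ∈ W₁` give the frame `P = (p₀ | p₁ | v₂)`
  have hassemble : ∀ (p₀ p₁ : Fin 3 → k) (a : k), gM *ᵥ p₀ = c₁ • p₀ + a • p₁ → gM *ᵥ p₁ = c₁ • p₁ →
      (∀ x y z : k, x • p₀ + y • p₁ + z • v₂ = 0 → x = 0 ∧ y = 0 ∧ z = 0) → B₀ τ 3 p₁ p₁ = 0 →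
      (a = 0 → B₀ τ 3 p₀ p₀ = 0 ∧ B₀ τ 3 p₀ p₁ ≠ 0) →
      ∃ P : GL (Fin 3) k,
        (((P⁻¹ : GL (Fin 3) k) : Matrix (Fin 3) (Fin 3) k) * gM * (P : Matrix (Fin 3) (Fin 3) k)) 0 0 = c₁ ∧
        (((P⁻¹ : GL (Fin 3) k) : Matrix (Fin 3) (Fin 3) k) * gM * (P : Matrix (Fin 3) (Fin 3) k)) 1 1 = c₁ ∧
        (((P⁻¹ : GL (Fin 3) k) : Matrix (Fin 3) (Fin 3) k) * gM * (P : Matrix (Fin 3) (Fin 3) k)) 2 2 = c₂ ∧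
        (∀ i j : Fin 3, i ≠ j → (i, j) ≠ ((1 : Fin 3), (0 : Fin 3)) →
          (((P⁻¹ : GL (Fin 3) k) : Matrix (Fin 3) (Fin 3) k) * gM * (P : Matrix (Fin 3) (Fin 3) k)) i j = 0) ∧
        B₀ τ 3 ((P : Matrix (Fin 3) (Fin 3) k).mulVec (Pi.single 2 1)) ((P : Matrix (Fin 3) (Fin 3) k).mulVec (Pi.single 2 1)) ≠ 0 ∧
        B₀ τ 3 ((P : Matrix (Fin 3) (Fin 3) k).mulVec (Pi.single 1 1)) ((P : Matrix (Fin 3) (Fin 3) k).mulVec (Pi.single 1 1)) = 0 ∧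
        ((((P⁻¹ : GL (Fin 3) k) : Matrix (Fin 3) (Fin 3) k) * gM * (P : Matrix (Fin 3) (Fin 3) k)) 1 0 = 0 →
          B₀ τ 3 ((P : Matrix (Fin 3) (Fin 3) k).mulVec (Pi.single 0 1)) ((P : Matrix (Fin 3) (Fin 3) k).mulVec (Pi.single 0 1)) = 0 ∧
          B₀ τ 3 ((P : Matrix (Fin 3) (Fin 3) k).mulVec (Pi.single 0 1)) ((P : Matrix (Fin 3) (Fin 3) k).mulVec (Pi.single 1 1)) ≠ 0) := by
    intro p₀ p₁ a hg0 hg1 hind hiso himp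
    obtain ⟨col, hcol0, hcol1, hcol2⟩ : ∃ col : Fin 3 → (Fin 3 → k), col 0 = p₀ ∧ col 1 = p₁ ∧ col 2 = v₂ := ⟨![p₀, p₁, v₂], rfl, rfl, rfl⟩
    set PM : Matrix (Fin 3) (Fin 3) k := Matrix.of fun i j => col j i with hPM
    have hcolj : ∀ j, PM *ᵥ Pi.single j 1 = col j := fun j => by funext i; rw [Matrix.mulVec_single_one]; rfl
    have hPMv : ∀ z : Fin 3 → k, PM *ᵥ z = z 0 • p₀ + z 1 • p₁ + z 2 • v₂ := by
      intro z
      have e : z = z 0 • (Pi.single 0 1 : Fin 3 → k) + z 1 • (Pi.single 1 1 : Fin 3 → k) + z 2 • (Pi.single 2 1 : Fin 3 → k) := by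
        funext i; fin_cases i <;> simp
      conv_lhs => rw [e]
      rw [Matrix.mulVec_add, Matrix.mulVec_add, Matrix.mulVec_smul, Matrix.mulVec_smul, Matrix.mulVec_smul, hcolj, hcolj, hcolj, hcol0, hcol1, hcol2]
    have hdet : PM.det ≠ 0 := by
      intro h0
      obtain ⟨z, hz0, hz⟩ := Matrix.exists_mulVec_eq_zero_iff.2 h0
      rw [hPMv] at hz
      obtain ⟨h0', h1', h2'⟩ := hind _ _ _ hz
      exact hz0 (by funext i; fin_cases i <;> assumption)
    have hU : IsUnit PM := (Matrix.isUnit_iff_isUnit_det PM).2 (isUnit_iff_ne_zero.2 hdet)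
    have hP : ((hU.unit : GL (Fin 3) k) : Matrix (Fin 3) (Fin 3) k) = PM := hU.unit_spec
    obtain ⟨QM, hQM⟩ : ∃ Q : Matrix (Fin 3) (Fin 3) k, Q = ((hU.unit⁻¹ : GL (Fin 3) k) : Matrix (Fin 3) (Fin 3) k) := ⟨_, rfl⟩
    have hQP : QM * PM = 1 := by
      have h : ((hU.unit⁻¹ : GL (Fin 3) k) : Matrix (Fin 3) (Fin 3) k) * ((hU.unit : GL (Fin 3) k) : Matrix (Fin 3) (Fin 3) k) = 1 := by
        rw [← Units.val_mul, inv_mul_cancel, Units.val_one]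
      rwa [hP, ← hQM] at h
    have hQcol : ∀ j, QM *ᵥ col j = Pi.single j 1 := fun j => by rw [← hcolj, Matrix.mulVec_mulVec, hQP, Matrix.one_mulVec]
    -- the columns of `A = P⁻¹ g P`
    have hA : ∀ i j, (QM * gM * PM) i j = (QM *ᵥ (gM *ᵥ col j)) i := fun i j => by
      rw [← hcolj, Matrix.mulVec_mulVec, Matrix.mulVec_mulVec, Matrix.mulVec_single_one]; rfl
    have hA0 : ∀ i, (QM * gM * PM) i 0 = (c₁ • (Pi.single 0 1 : Fin 3 → k) + a • (Pi.single 1 1 : Fin 3 → k)) i := fun i => by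
      rw [hA, hcol0, hg0, Matrix.mulVec_add, Matrix.mulVec_smul, Matrix.mulVec_smul, ← hcol0, hQcol, ← hcol1, hQcol]
    have hA1 : ∀ i, (QM * gM * PM) i 1 = (c₁ • (Pi.single 1 1 : Fin 3 → k)) i := fun i => by
      rw [hA, hcol1, hg1, Matrix.mulVec_smul, ← hcol1, hQcol]
    have hA2 : ∀ i, (QM * gM * PM) i 2 = (c₂ • (Pi.single 2 1 : Fin 3 → k)) i := fun i => by
      rw [hA, hcol2, hgv₂, Matrix.mulVec_smul, ← hcol2, hQcol]
    refine ⟨hU.unit, ?_⟩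
    rw [← hQM, hP]
    refine ⟨by rw [hA0]; simp, by rw [hA1]; simp, by rw [hA2]; simp, fun i j hij hne10 => ?_, by rw [hcolj, hcol2]; exact hv₂an,
      by rw [hcolj, hcol1]; exact hiso, fun h10 => ?_⟩
    · fin_cases i <;> fin_cases j
      · exact absurd rfl hij
      · exact (hA1 0).trans (by simp)
      · exact (hA2 0).trans (by simp)
      · exact absurd rfl hne10
      · exact absurd rfl hij
      · exact (hA2 1).trans (by simp)
      · exact (hA0 2).trans (by simp)
      · exact (hA1 2).trans (by simp)
      · exact absurd rfl hij
    · have ha : a = 0 := by have h := hA0 1; rw [h10] at h; simpa using h.symm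
      rw [hcolj, hcolj, hcol0, hcol1]
      exact himp ha
  -- THE PLANE `W₁`: `N`-stable, `N² = 0`; the independence test against `v₂`
  have hNW₁ : ∀ w ∈ W₁, N w ∈ W₁ := fun w hw => by rw [hmemW₁] at hw ⊢; rw [hw, hN0]
  have hgN : ∀ x, gM *ᵥ x = c₁ • x + N x := fun x => by rw [hN]; abel
  have hsplit : ∀ (p₀ p₁ : Fin 3 → k), p₀ ∈ W₁ → p₁ ∈ W₁ → ∀ x y z : k, x • p₀ + y • p₁ + z • v₂ = 0 → x • p₀ + y • p₁ = 0 ∧ z = 0 := by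
    intro p₀ p₁ hp₀ hp₁ x y z h
    have hu : x • p₀ + y • p₁ ∈ W₁ := W₁.add_mem (W₁.smul_mem x hp₀) (W₁.smul_mem y hp₁)
    have hu0 : x • p₀ + y • p₁ = 0 := by
      refine (Submodule.disjoint_def.1 hdisj) _ hu ?_
      rw [eq_neg_of_add_eq_zero_left h]
      exact W₂.neg_mem (W₂.smul_mem z hv₂W)
    refine ⟨hu0, ?_⟩
    rw [hu0, zero_add] at h
    exact (smul_eq_zero.1 h).resolve_right hv₂0
  by_cases hNz : ∀ w ∈ W₁, N w = 0
  · -- CASE (i): `g = c₁` on `W₁` — a hyperbolic pair `p₀, p₁` of the non-degenerate plane `W₁`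
    have hgW : ∀ w ∈ W₁, gM *ᵥ w = c₁ • w := fun w hw => by rw [hgN, hNz w hw, add_zero]
    have hfix : ∀ x, τ (B₀ τ 3 x x) = B₀ τ 3 x x := fun x => (herm x x).symm
    -- an isotropic non-zero vector of `W₁`
    have hiso_ex : ∃ p ∈ W₁, p ≠ 0 ∧ B₀ τ 3 p p = 0 := by
      obtain ⟨e, he0⟩ := Module.finrank_pos_iff_exists_ne_zero.1 (show 0 < finrank k W₁ by omega)
      obtain ⟨e', hee'⟩ := exists_linearIndependent_pair_of_one_lt_finrank (show 1 < finrank k W₁ by omega) he0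
      have hpair := LinearIndependent.pair_iff.1 hee'
      have heV0 : (e : Fin 3 → k) ≠ 0 := fun h => he0 (Subtype.ext h)
      by_cases ha : B₀ τ 3 (e : Fin 3 → k) e = 0
      · exact ⟨e, e.2, heV0, ha⟩
      -- `e'' = e' − s e ⊥ e`
      obtain ⟨s, hs⟩ : ∃ s : k, s = B₀ τ 3 (e : Fin 3 → k) e' / B₀ τ 3 (e : Fin 3 → k) e := ⟨_, rfl⟩
      obtain ⟨e'', he''⟩ : ∃ e'' : Fin 3 → k, e'' = (e' : Fin 3 → k) - s • (e : Fin 3 → k) := ⟨_, rfl⟩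
      have he''W : e'' ∈ W₁ := by rw [he'']; exact W₁.sub_mem e'.2 (W₁.smul_mem s e.2)
      have horth : B₀ τ 3 (e : Fin 3 → k) e'' = 0 := by rw [he'', map_sub, hBsr, hs, div_mul_cancel₀ _ ha, sub_self]
      have horth' : B₀ τ 3 e'' e = 0 := by rw [herm, horth, map_zero]
      have hcomb0 : ∀ x y : k, x • (e : Fin 3 → k) + y • e'' = 0 → x - y * s = 0 ∧ y = 0 := by
        intro x y h
        have h' : (x - y * s) • e + y • e' = 0 := by
          apply Subtype.ext
          simp only [Submodule.coe_add, Submodule.coe_smul, Submodule.coe_zero]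
          rw [← h, he'', smul_sub, sub_smul, mul_smul]; abel
        exact hpair _ _ h'
      have he''0 : e'' ≠ 0 := fun h => by
        have h1 := (hcomb0 0 1 (by rw [h, zero_smul, smul_zero, add_zero])).2; exact one_ne_zero h1
      by_cases hb : B₀ τ 3 e'' e'' = 0
      · exact ⟨e'', he''W, he''0, hb⟩
      -- solve the norm equation `τt·t = −B(e,e)/B(e'',e'')` over the finite field
      have hr : τ (-(B₀ τ 3 (e : Fin 3 → k) e / B₀ τ 3 e'' e'')) = -(B₀ τ 3 (e : Fin 3 → k) e / B₀ τ 3 e'' e'') := by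
        rw [map_neg, map_div₀, hfix, hfix]
      have hr0 : -(B₀ τ 3 (e : Fin 3 → k) e / B₀ τ 3 e'' e'') ≠ 0 := neg_ne_zero.2 (div_ne_zero ha hb)
      have hcard := natCard_norm_eq hq τ hτ hr hr0
      obtain ⟨⟨t, ht⟩⟩ := (Nat.card_ne_zero.1 (by rw [hcard]; exact Nat.succ_ne_zero q)).1
      refine ⟨(e : Fin 3 → k) + t • e'', W₁.add_mem e.2 (W₁.smul_mem t he''W), fun h => ?_, ?_⟩
      · have h1 := hcomb0 1 t (by rw [one_smul]; exact h)
        rw [h1.2, zero_mul, sub_zero] at h1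
        exact one_ne_zero h1.1
      · simp only [map_add, LinearMap.add_apply, hBsl, hBsr, horth, horth', mul_zero, add_zero, zero_add]
        rw [← mul_assoc, ht]
        field_simp
        ring
    obtain ⟨p₁, hp₁W, hp₁0, hp₁iso⟩ := hiso_ex
    -- a hyperbolic partner `p₀ = w + (t/β) p₁`
    obtain ⟨w, hwW, hw⟩ : ∃ w ∈ W₁, B₀ τ 3 p₁ w ≠ 0 := by
      by_contra h
      push Not at h
      exact hp₁0 (hW₁nondeg p₁ hp₁W h)
    obtain ⟨β, hβ⟩ : ∃ β : k, β = B₀ τ 3 w p₁ := ⟨_, rfl⟩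
    have hβτ : B₀ τ 3 p₁ w = τ β := by rw [hβ, ← herm]
    have hβ0 : β ≠ 0 := fun h0 => hw (by rw [hβτ, h0, map_zero])
    obtain ⟨t, ht⟩ := exists_trace_eq hq τ hτ (e := -B₀ τ 3 w w) (by rw [map_neg, hfix])
    obtain ⟨p₀, hp₀⟩ : ∃ p : Fin 3 → k, p = w + (t / β) • p₁ := ⟨_, rfl⟩
    have hp₀W : p₀ ∈ W₁ := by rw [hp₀]; exact W₁.add_mem hwW (W₁.smul_mem _ hp₁W)
    have hp₀₁ : B₀ τ 3 p₀ p₁ = β := by rw [hp₀, map_add, LinearMap.add_apply, hBsl, hp₁iso, mul_zero, add_zero, hβ]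
    have hp₀iso : B₀ τ 3 p₀ p₀ = 0 := by
      have e1 : B₀ τ 3 p₀ p₀ = B₀ τ 3 w w + t / β * β + τ (t / β) * τ β := by
        conv_lhs => rw [hp₀]
        simp only [map_add, LinearMap.add_apply, hBsl, hBsr, hp₁iso, hβτ, ← hβ, mul_zero, add_zero]
        ring
      rw [e1, ← map_mul, div_mul_cancel₀ _ hβ0]
      linear_combination ht
    have hind : ∀ x y z : k, x • p₀ + y • p₁ + z • v₂ = 0 → x = 0 ∧ y = 0 ∧ z = 0 := by
      intro x y z h
      obtain ⟨hu0, hz⟩ := hsplit p₀ p₁ hp₀W hp₁W x y z h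
      have hx : x = 0 := by
        have h1 : B₀ τ 3 (x • p₀ + y • p₁) p₁ = 0 := by rw [hu0, map_zero, LinearMap.zero_apply]
        rw [map_add, LinearMap.add_apply, hBsl, hBsl, hp₀₁, hp₁iso, mul_zero, add_zero] at h1
        rcases mul_eq_zero.1 h1 with h2 | h2
        · have h3 : τ (τ x) = τ 0 := by rw [h2]
          rwa [hττ, map_zero] at h3
        · exact absurd h2 hβ0
      refine ⟨hx, ?_, hz⟩
      rw [hx, zero_smul, zero_add] at hu0
      exact (smul_eq_zero.1 hu0).resolve_right hp₁0
    exact hassemble p₀ p₁ 0 (by rw [hgW p₀ hp₀W, zero_smul, add_zero]) (hgW p₁ hp₁W) hind hp₁iso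
      (fun _ => ⟨hp₀iso, by rw [hp₀₁]; exact hβ0⟩)
  · -- CASE (ii): `N ≠ 0` on `W₁` — `p₁ = N p₀` is an isotropic `c₁`-eigenvector
    push Not at hNz
    obtain ⟨p₀, hp₀W, hp₁0⟩ := hNz
    obtain ⟨p₁, hp₁⟩ : ∃ p : Fin 3 → k, p = N p₀ := ⟨_, rfl⟩
    rw [← hp₁] at hp₁0
    have hp₁W : p₁ ∈ W₁ := by rw [hp₁]; exact hNW₁ p₀ hp₀W
    have hNp₁ : N p₁ = 0 := by rw [hp₁]; exact (hmemW₁ p₀).1 hp₀W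
    have hg0 : gM *ᵥ p₀ = c₁ • p₀ + (1 : k) • p₁ := by rw [hgN, one_smul, hp₁]
    have hg1 : gM *ᵥ p₁ = c₁ • p₁ := by rw [hgN, hNp₁, add_zero]
    have hiso : B₀ τ 3 p₁ p₁ = 0 := by
      have h := hB p₀ p₁
      rw [hg0, hg1, one_smul, map_add, LinearMap.add_apply, hBsl, hBsr, hBsr] at h
      have h' : c₁ * B₀ τ 3 p₁ p₁ = 0 := by linear_combination h - (B₀ τ 3 p₀ p₁) * hu₁
      exact (mul_eq_zero.1 h').resolve_left hc₁0
    have hind : ∀ x y z : k, x • p₀ + y • p₁ + z • v₂ = 0 → x = 0 ∧ y = 0 ∧ z = 0 := by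
      intro x y z h
      obtain ⟨hu0, hz⟩ := hsplit p₀ p₁ hp₀W hp₁W x y z h
      have hx : x = 0 := by
        have h' := congrArg N hu0
        rw [hNlin, hNp₁, smul_zero, add_zero, hN0, ← hp₁] at h'
        exact (smul_eq_zero.1 h').resolve_right hp₁0
      refine ⟨hx, ?_, hz⟩
      rw [hx, zero_smul, zero_add] at hu0
      exact (smul_eq_zero.1 hu0).resolve_right hp₁0
    exact hassemble p₀ p₁ 1 hg0 hg1 hind hiso (fun h => absurd h one_ne_zero)

end Summit.HodgeConjecture.HodgeConjecture.R90.S6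

end
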